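import Summits.Ventures.LatticeQCDFlow.Scaling.IdealStarPooledCollector
import Summits.Ventures.LatticeQCDFlow.Scaling.IdealStarStaleMoments

/-!
HONEST FRAMING: exact (Metropolis-corrected) sampling algorithms for lattice gauge theory; figures
of merit are autocorrelation/cost numbers at stated couplings and volumes; no continuum-physics
claim.

# IdealStarLawFreeKLogK — THE LAW-FREE `½·log K` FLOOR IN THE CEILING'S UNIT `K/(t(1−t))`: FOR THE IDEALISED STAR AND ANY CONTENT LAW WITH SOME `ν(u) ≤ ½`,
# `‖δ_{y_u}Pⁿ − ν^{⊗(K+1)}‖_TV ≥ ½` WHILE `(1−t(1−t)/K)ⁿ(K+t) ≥ max{260, 8√(2(K+1))}`, HENCE `t_mix(1/4) ≥ (K/(t(1−t)) − 1)·log((K+t)/max{260, 8√(2(K+1))})` — ORDER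
# `(K/(2t(1−t)))·log K`, TWO CONTENTS SUFFICE (lean-2 GEN-45, ours)

Venture-side (OURS).  Cell `lqcd-flow` (pub-lqcd), unit `pub-lqcd-lean-2-g45`, 2026-08-31.  Chapter AE, file 12 — file 7's argument with file 11's survival of the stale POTENTIAL
(`Φ = |D∖{0}| + t𝟙{0∈D} ≤ |D|`, rate `λ = t(1−t)/K`) in place of file 5's survival of the stale cold count (rate `t/K`): on `{Φ(D_n) ≥ 4λ_dev}` the `u`-count deficit forces a
binomial deviation of the clean levels (file 6 + L14), and `Φ(D_n) ≥ s/2 ≥ 4λ_dev` fails with probability `≤ (64s+36)/s²`.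

* **`idealStar_count_deficit_le_unit`**, **`idealStar_tvDist_ge_lawFree_unit`** (`TV ≥ ½` while `s ≥ max{260, 8√(2(K+1))}`),
  **`idealStar_mixingTime_ge_lawFree_unit`** (**`t_mix(1/4) ≥ (K/(t(1−t)) − 1)·log((K+t)/max{260, 8√(2(K+1))})`**),
  **`idealStar_KlogK_lawFree_unit`** (with L15: `… ≤ t_mix(1/4) ≤ ⌈(2m/(t(1−t)c))·log(4(K+1)/t)⌉` — BOTH SIDES IN THE UNIT `K/(t(1−t))`, for every content law on every `|S| ≥ 2`).

Reading (no numerics implied): GEN-27's `(K/(t(1−t)) − 1)·log(K/32) ≤ t_mix(1/4)` needed `|S| ≥ 20(K+1)`; here the same unit with half the logarithm holds for two contents.  TOY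
(session folder `numerics45/two_content_toy.py`, NOTHING CLAIMED): the exact two-content lumped chain has `t_mix(1/4)·t/K` growing by `0.459 ∕ 0.688 ∕ 1.351` per doubling of `K` at
`t = 0.25 ∕ 0.5 ∕ 0.75` against `½·log 2/(1−t) = 0.462 ∕ 0.693 ∕ 1.386` — the order `(K/(2t(1−t)))·log K` of this floor is the truth there.  Literature grade (cell rule): OWN
(two-moment method; LPW §7.3.1 mechanism); nothing cited as a fact; no new bib keys.
-/

noncomputable section

open Finset Function
open Literature.Probability.MarkovChains

namespace Summit.Ventures.LatticeQCDFlow.Scaling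

section LawFreeUnit
variable {S : Type*} [Fintype S] [DecidableEq S] {K m : ℕ} (κ : Fin m → Fin K) {ν : S → ℝ} {M : Fin (K + 1) → S → S → ℝ} {t : ℝ}

/-- **THE CHAIN SIDE IN THE UNIT `K/(t(1−t))`:** from `y_u ≡ u`, for `λ > 0` with `8λ ≤ s = (1−t(1−t)/K)ⁿ(K+t)` (`0 < t < 1`, `K ≥ 2`, `ν(u) ≤ ½`, `m = cK`):
**`(δ_{y_u}Pⁿ){z : N(u)(z) < (K+1)ν(u) + λ} ≤ (64s+36)/s² + (K+1)ν(u)(1−ν(u))/λ²`**. [ours] -/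
theorem idealStar_count_deficit_le_unit (hm : 1 ≤ m) (ht0 : 0 < t) (ht1 : t < 1) (hK : 2 ≤ K) (hν : ∀ v, 0 < ν v) (hν1 : ∑ v, ν v = 1)
    (hM : ∀ k, IsRowStochastic (M k)) (hM0 : ∀ u v, M 0 u v = ν v)
    {c : ℕ} (hunif : ∀ i : Fin K, (univ.filter fun r : Fin m => κ r = i).card = c) (hmc : m = c * K)
    (u : S) (hu : ν u ≤ 1 / 2) (n : ℕ) {lam : ℝ} (hlam : 0 < lam) (hs : 8 * lam ≤ (1 - t * (1 - t) / K) ^ n * ((K : ℝ) + t)) :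
    ∑ z ∈ univ.filter (fun z : Fin (K + 1) → S => ∑ k, (if z k = u then (1 : ℝ) else 0) < ((K : ℝ) + 1) * ν u + lam),
        lawAt (fun y z : Fin (K + 1) → S => t * ptGraphSwap (fun _ : Fin (K + 1) => ν)
          (fun r : Fin m => (((0 : Fin (K + 1)), (κ r).succ) : Fin (K + 1) × Fin (K + 1))) (fun _ => Equiv.refl S) y z
          + (1 - t) * prodKernel (fun k : Fin (K + 1) => if k = 0 then (1 : ℝ) else 0) M y z) (Pi.single (fun _ : Fin (K + 1) => u) 1) n z
      ≤ (64 * ((1 - t * (1 - t) / K) ^ n * ((K : ℝ) + t)) + 36) / ((1 - t * (1 - t) / K) ^ n * ((K : ℝ) + t)) ^ 2 + ((K : ℝ) + 1) * (ν u * (1 - ν u)) / lam ^ 2 := by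
  classical
  -- the augmented chain and the set chain (chapter L files 12–13)
  obtain ⟨Ph, hPh⟩ : ∃ Ph : (Fin (K + 1) → S) × Finset (Fin (K + 1)) → (Fin (K + 1) → S) × Finset (Fin (K + 1)) → ℝ, ∀ p q, Ph p q = ∑ r : Fin m, t / m *
        (if q.1 = edgeFlowSwap (Equiv.refl S) 0 (κ r).succ p.1 ∧ q.2 = p.2.image (Equiv.swap (0 : Fin (K + 1)) (κ r).succ)
          then (1 : ℝ) else 0)
      + (1 - t) * (coordKernel M 0 p.1 q.1 * (if q.2 = p.2.erase 0 then (1 : ℝ) else 0)) := ⟨fun p q => _, fun _ _ => rfl⟩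
  obtain ⟨Q, hQ⟩ : ∃ Q : Finset (Fin (K + 1)) → Finset (Fin (K + 1)) → ℝ, ∀ D D', Q D D' = ∑ r : Fin m, t / m *
      (if D' = D.image (Equiv.swap (0 : Fin (K + 1)) (κ r).succ) then (1 : ℝ) else 0) + (1 - t) * (if D' = D.erase 0 then (1 : ℝ) else 0) := ⟨fun D D' => _, fun _ _ => rfl⟩
  set x₀ : Fin (K + 1) → S := fun _ => u with hx₀
  set L := lawAt Ph (Pi.single (x₀, (univ : Finset (Fin (K + 1)))) 1) n with hL
  have hfst := ideal_lawAt_fst κ hm hν hPh x₀ n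
  have hsnd := ideal_lawAt_snd κ hM hPh hQ x₀ n
  have hfresh := ideal_fresh_lawAt κ hM0 hPh x₀ n
  have hsupp := ideal_lawAt_stale_const κ hPh u n
  have hPhrs := ideal_aug_isRowStochastic κ hm ht0.le ht1.le hM hPh
  have hL0 : ∀ p, 0 ≤ L p := lawAt_nonneg hPhrs (fun p => by rw [Pi.single_apply]; split_ifs <;> norm_num) n
  have hQrs : IsRowStochastic Q := dirty_isRowStochastic κ hm ht0.le ht1.le hQ
  have hQ1 : ∑ D, lawAt Q (Pi.single (univ : Finset (Fin (K + 1))) 1) n D = 1 := by rw [sum_lawAt hQrs, Finset.sum_pi_single']; simp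
  have hQ0 : ∀ D, 0 ≤ lawAt Q (Pi.single (univ : Finset (Fin (K + 1))) 1) n D :=
    lawAt_nonneg hQrs (fun D => by rw [Pi.single_apply]; split_ifs <;> norm_num) n
  set s : ℝ := (1 - t * (1 - t) / K) ^ n * ((K : ℝ) + t) with hsdef
  have hspos : 0 < s := by linarith
  set Φ : Finset (Fin (K + 1)) → ℝ := fun D => ((D.erase 0).card : ℝ) + t * (if (0 : Fin (K + 1)) ∈ D then (1 : ℝ) else 0) with hΦ
  -- rewrite the configuration law through the augmentation
  rw [sum_congr rfl fun z _ => (hfst z).symm, sum_comm]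
  -- per stale set: deficit ⊆ {few stale cold levels} ∪ {binomial deviation}
  set m₀ : ℝ := 4 * lam with hm₀
  have hper : ∀ D : Finset (Fin (K + 1)),
      ∑ z ∈ univ.filter (fun z : Fin (K + 1) → S => ∑ k, (if z k = u then (1 : ℝ) else 0) < ((K : ℝ) + 1) * ν u + lam), L (z, D)
        ≤ (if Φ D < m₀ then ∑ z, L (z, D) else 0)
          + ∑ z ∈ univ.filter (fun z : Fin (K + 1) → S => lam ^ 2 ≤ (∑ k ∈ univ \ D, (if z k = u then (1 : ℝ) else 0) - ((univ \ D).card : ℝ) * ν u) ^ 2), L (z, D) := by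
    intro D
    by_cases hG : Φ D < m₀
    · rw [if_pos hG]
      have h1 : ∑ z ∈ univ.filter (fun z : Fin (K + 1) → S => ∑ k, (if z k = u then (1 : ℝ) else 0) < ((K : ℝ) + 1) * ν u + lam), L (z, D) ≤ ∑ z, L (z, D) :=
        sum_le_sum_of_subset_of_nonneg (filter_subset _ _) fun z _ _ => hL0 _
      have h2 : 0 ≤ ∑ z ∈ univ.filter (fun z : Fin (K + 1) → S => lam ^ 2 ≤ (∑ k ∈ univ \ D, (if z k = u then (1 : ℝ) else 0) - ((univ \ D).card : ℝ) * ν u) ^ 2), L (z, D) :=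
        sum_nonneg fun z _ => hL0 _
      linarith
    · rw [if_neg hG, zero_add]
      push Not at hG
      -- on the support the deficit forces the deviation
      rw [Finset.sum_filter, Finset.sum_filter]
      refine sum_le_sum fun z _ => ?_
      by_cases hdef : ∑ k, (if z k = u then (1 : ℝ) else 0) < ((K : ℝ) + 1) * ν u + lam
      · rw [if_pos hdef]
        by_cases hLz : L (z, D) = 0
        · rw [hLz]; split_ifs <;> exact le_rfl
        · have hz : ∀ k ∈ D, z k = u := hsupp z D hLz
          -- `N(u) = |D| + B_D`
          have hcnt : ∑ k, (if z k = u then (1 : ℝ) else 0) = (D.card : ℝ) + ∑ k ∈ univ \ D, (if z k = u then (1 : ℝ) else 0) := by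
            rw [← Finset.sum_add_sum_compl D, Finset.compl_eq_univ_sdiff]
            congr 1
            rw [sum_congr rfl fun k hk => if_pos (hz k hk), sum_const, nsmul_eq_mul, mul_one]
          have hcardD : Φ D ≤ (D.card : ℝ) := by
            have h1 := Finset.card_erase_add_one (s := D) (a := 0)
            rw [hΦ]; simp only
            by_cases h0 : (0 : Fin (K + 1)) ∈ D
            · rw [if_pos h0]; have := h1 h0; have : (((D.erase 0).card : ℕ) : ℝ) + 1 = (D.card : ℝ) := by exact_mod_cast this
              linarith
            · rw [if_neg h0, Finset.erase_eq_of_notMem h0]; linarith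
          have hNK : ((univ \ D).card : ℝ) + (D.card : ℝ) = (K : ℝ) + 1 := by
            have h := Finset.card_sdiff_add_card_eq_card (subset_univ D)
            rw [card_univ, Fintype.card_fin] at h
            exact_mod_cast h
          rw [hcnt] at hdef
          have hdev : ∑ k ∈ univ \ D, (if z k = u then (1 : ℝ) else 0) - ((univ \ D).card : ℝ) * ν u ≤ -lam := by nlinarith
          have hsq : lam ^ 2 ≤ (∑ k ∈ univ \ D, (if z k = u then (1 : ℝ) else 0) - ((univ \ D).card : ℝ) * ν u) ^ 2 := by nlinarith
          rw [if_pos hsq]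
      · rw [if_neg hdef]; split_ifs <;> first | exact le_rfl | exact hL0 _
  refine (sum_le_sum fun D _ => hper D).trans ?_
  rw [sum_add_distrib]
  -- first part: the stale potential is rarely below `s/2 ≥ m₀` (file 11)
  have hfirst : ∑ D : Finset (Fin (K + 1)), (if Φ D < m₀ then ∑ z, L (z, D) else 0) ≤ (64 * s + 36) / s ^ 2 := by
    have e1 : ∑ D : Finset (Fin (K + 1)), (if Φ D < m₀ then ∑ z, L (z, D) else 0)
        = ∑ D ∈ univ.filter (fun D : Finset (Fin (K + 1)) => Φ D < m₀), lawAt Q (Pi.single (univ : Finset (Fin (K + 1))) 1) n D := by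
      rw [Finset.sum_filter]; refine sum_congr rfl fun D _ => ?_
      rw [← hsnd D, hL]
    have hsub : ∑ D ∈ univ.filter (fun D : Finset (Fin (K + 1)) => Φ D < m₀), lawAt Q (Pi.single (univ : Finset (Fin (K + 1))) 1) n D
        ≤ ∑ D ∈ univ.filter (fun D : Finset (Fin (K + 1)) => ¬ (s / 2 ≤ Φ D)), lawAt Q (Pi.single (univ : Finset (Fin (K + 1))) 1) n D :=
      sum_le_sum_of_subset_of_nonneg (fun D hD => by
        rw [mem_filter] at hD ⊢; exact ⟨hD.1, not_le.mpr (lt_of_lt_of_le hD.2 (by linarith))⟩) fun D _ _ => hQ0 D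
    have hsplit := Finset.sum_filter_add_sum_filter_not univ (fun D : Finset (Fin (K + 1)) => s / 2 ≤ Φ D)
      (fun D => lawAt Q (Pi.single (univ : Finset (Fin (K + 1))) 1) n D)
    rw [hQ1] at hsplit
    have hmass := idealStar_stalePotential_mass_ge κ hm ht0 ht1 hK hQ hunif hmc n
    rw [← hsdef] at hmass
    rw [e1]; linarith
  -- second part: Chebyshev per stale set (file 6), summed with `Σ_D Σ_z L = 1`
  have hsecond : ∑ D : Finset (Fin (K + 1)), ∑ z ∈ univ.filter (fun z : Fin (K + 1) → S => lam ^ 2 ≤ (∑ k ∈ univ \ D, (if z k = u then (1 : ℝ) else 0) - ((univ \ D).card : ℝ) * ν u) ^ 2), L (z, D)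
      ≤ ((K : ℝ) + 1) * (ν u * (1 - ν u)) / lam ^ 2 := by
    have hνu : 0 ≤ ν u * (1 - ν u) := mul_nonneg (hν u).le (by linarith)
    have hlam2 : 0 < lam ^ 2 := by positivity
    have hD : ∀ D : Finset (Fin (K + 1)), ∑ z ∈ univ.filter (fun z : Fin (K + 1) → S => lam ^ 2 ≤ (∑ k ∈ univ \ D, (if z k = u then (1 : ℝ) else 0) - ((univ \ D).card : ℝ) * ν u) ^ 2), L (z, D)
        ≤ ((K : ℝ) + 1) * (ν u * (1 - ν u)) / lam ^ 2 * ∑ z, L (z, D) := by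
      intro D
      have h := fresh_count_chebyshev (ρ := fun z => L (z, D)) (fun z k v hk => hfresh z D k v hk) (fun z => hL0 _) hν1 u hlam2
      refine h.trans (mul_le_mul_of_nonneg_right ?_ (sum_nonneg fun z _ => hL0 _))
      refine div_le_div_of_nonneg_right (mul_le_mul_of_nonneg_right ?_ hνu) hlam2.le
      have : (univ \ D).card ≤ K + 1 := by
        have := Finset.card_le_univ (univ \ D); rw [Fintype.card_fin] at this; exact this
      exact_mod_cast this
    refine (sum_le_sum fun D _ => hD D).trans ?_
    rw [← mul_sum, sum_congr rfl fun D _ => hsnd D, hQ1, mul_one]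
  rw [hsdef] at hfirst
  linarith

/-- **THE LAW-FREE FLOOR ON THE DISTANCE, UNIT `K/(t(1−t))`:** with `s = (1−t(1−t)/K)ⁿ(K+t) ≥ 260` and `s ≥ 8√(2(K+1))` (`0 < t < 1`, `K ≥ 2`, `ν(u) ≤ ½`, `m = cK`):
**`‖δ_{y_u}Pⁿ − ν^{⊗(K+1)}‖_TV ≥ 1/2`**, witnessed by the composition event `{N(u) ≥ (K+1)ν(u) + √(2(K+1))}`. [ours] -/
theorem idealStar_tvDist_ge_lawFree_unit (hm : 1 ≤ m) (ht0 : 0 < t) (ht1 : t < 1) (hK : 2 ≤ K) (hν : ∀ v, 0 < ν v) (hν1 : ∑ v, ν v = 1)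
    (hM : ∀ k, IsRowStochastic (M k)) (hM0 : ∀ u v, M 0 u v = ν v)
    {c : ℕ} (hunif : ∀ i : Fin K, (univ.filter fun r : Fin m => κ r = i).card = c) (hmc : m = c * K)
    (u : S) (hu : ν u ≤ 1 / 2) (n : ℕ) (hs64 : 260 ≤ (1 - t * (1 - t) / K) ^ n * ((K : ℝ) + t)) (hs : 8 * Real.sqrt (2 * ((K : ℝ) + 1)) ≤ (1 - t * (1 - t) / K) ^ n * ((K : ℝ) + t)) :
    1 / 2 ≤ tvDist (lawAt (fun y z : Fin (K + 1) → S => t * ptGraphSwap (fun _ : Fin (K + 1) => ν)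
          (fun r : Fin m => (((0 : Fin (K + 1)), (κ r).succ) : Fin (K + 1) × Fin (K + 1))) (fun _ => Equiv.refl S) y z
          + (1 - t) * prodKernel (fun k : Fin (K + 1) => if k = 0 then (1 : ℝ) else 0) M y z) (Pi.single (fun _ : Fin (K + 1) => u) 1) n)
        (tensorFun (fun _ : Fin (K + 1) => ν)) := by
  classical
  set lam : ℝ := Real.sqrt (2 * ((K : ℝ) + 1)) with hlamdef
  have hK0 : (0 : ℝ) ≤ K := Nat.cast_nonneg _
  have hlam : 0 < lam := Real.sqrt_pos.mpr (by positivity)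
  have hlam2 : lam ^ 2 = 2 * ((K : ℝ) + 1) := Real.sq_sqrt (by positivity)
  set s : ℝ := (1 - t * (1 - t) / K) ^ n * ((K : ℝ) + t) with hsdef
  -- the two Chebyshev terms are `≤ 1/8` each
  have hνu : ν u * (1 - ν u) ≤ 1 / 4 := by nlinarith
  have hcheb : ((K : ℝ) + 1) * (ν u * (1 - ν u)) / lam ^ 2 ≤ 1 / 8 := by
    rw [hlam2, div_le_iff₀ (by positivity)]; nlinarith
  have hdef := idealStar_count_deficit_le_unit κ hm ht0 ht1 hK hν hν1 hM hM0 hunif hmc u hu n hlam hs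
  have hexc := tensor_count_excess_le (K := K) hν hν1 u hlam
  have h4s : (64 * s + 36) / s ^ 2 ≤ 1 / 4 := by rw [div_le_div_iff₀ (by positivity) (by norm_num)]; nlinarith
  -- masses
  set P := (fun y z : Fin (K + 1) → S => t * ptGraphSwap (fun _ : Fin (K + 1) => ν)
          (fun r : Fin m => (((0 : Fin (K + 1)), (κ r).succ) : Fin (K + 1) × Fin (K + 1))) (fun _ => Equiv.refl S) y z
          + (1 - t) * prodKernel (fun k : Fin (K + 1) => if k = 0 then (1 : ℝ) else 0) M y z) with hP
  have hν' : ∀ (k : Fin (K + 1)) (v : S), 0 < (fun _ : Fin (K + 1) => ν) k v := fun _ v => hν v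
  have hw0 : ∀ k : Fin (K + 1), 0 ≤ (if k = 0 then (1 : ℝ) else 0) := fun k => by split_ifs <;> norm_num
  have hw1 : ∑ k : Fin (K + 1), (if k = 0 then (1 : ℝ) else 0) = 1 := by rw [Finset.sum_ite_eq' univ (0 : Fin (K + 1))]; simp
  have hPrs : IsRowStochastic P := by
    have h1 := ptGraphSwap_isRowStochastic (e := fun r : Fin m => (((0 : Fin (K + 1)), (κ r).succ) : Fin (K + 1) × Fin (K + 1))) (φ := fun _ => Equiv.refl S) hν'
    have h2 := prodKernel_isRowStochastic (P := M) (w := fun k : Fin (K + 1) => if k = 0 then (1 : ℝ) else 0) hw0 hw1 hM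
    refine ⟨fun y z => add_nonneg (mul_nonneg ht0.le (h1.1 y z)) (mul_nonneg (by linarith) (h2.1 y z)), fun y => ?_⟩
    rw [hP]; simp only
    rw [sum_add_distrib, ← mul_sum, ← mul_sum, h1.2 y, h2.2 y]; ring
  have hμ0' : ∀ y, 0 ≤ (Pi.single (fun _ : Fin (K + 1) => u) (1 : ℝ) : (Fin (K + 1) → S) → ℝ) y := fun y => by rw [Pi.single_apply]; split_ifs <;> norm_num
  have hl1 : ∑ z, lawAt P (Pi.single (fun _ : Fin (K + 1) => u) 1) n z = ∑ z, tensorFun (fun _ : Fin (K + 1) => ν) z := by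
    rw [sum_lawAt hPrs, Finset.sum_pi_single', if_pos (mem_univ _), sum_tensorFun_eq_one _ (fun _ => hν1)]
  have hl1' : ∑ z, lawAt P (Pi.single (fun _ : Fin (K + 1) => u) 1) n z = 1 := by rw [hl1, sum_tensorFun_eq_one _ (fun _ => hν1)]
  -- the event `A = {N(u) ≥ (K+1)ν(u) + λ}` and its complement
  have hAc : univ.filter (fun z : Fin (K + 1) → S => ∑ k, (if z k = u then (1 : ℝ) else 0) < ((K : ℝ) + 1) * ν u + lam)
      = univ.filter (fun z : Fin (K + 1) → S => ¬ (((K : ℝ) + 1) * ν u + lam ≤ ∑ k, (if z k = u then (1 : ℝ) else 0))) := by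
    simp only [not_le]
  have hsplit := Finset.sum_filter_add_sum_filter_not univ (fun z : Fin (K + 1) → S => ((K : ℝ) + 1) * ν u + lam ≤ ∑ k, (if z k = u then (1 : ℝ) else 0))
    (fun z => lawAt P (Pi.single (fun _ : Fin (K + 1) => u) 1) n z)
  rw [hl1'] at hsplit
  rw [hAc] at hdef
  have htv := sub_sum_le_tvDist hl1 (univ.filter (fun z : Fin (K + 1) → S => ((K : ℝ) + 1) * ν u + lam ≤ ∑ k, (if z k = u then (1 : ℝ) else 0)))
  linarith

/-- **THE LAW-FREE `½·log K` FLOOR IN THE CEILING'S UNIT, as printed:** idealised hot-only star at uniform listing (`c ≥ 1`, `m = cK`), `0 < t < 1`, `K ≥ 2`, exact hot sampler, `ν`-reversible cold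
kernels, ANY positive content law `ν` with some `ν(u) ≤ ½`: **`t_mix(1/4) ≥ (K/(t(1−t)) − 1)·log((K+t)/max{260, 8√(2(K+1))})`**. [ours] -/
theorem idealStar_mixingTime_ge_lawFree_unit (hm : 1 ≤ m) (ht0 : 0 < t) (ht1 : t < 1) (hK : 2 ≤ K) (hν : ∀ v, 0 < ν v) (hν1 : ∑ v, ν v = 1)
    (hM : ∀ k, IsRowStochastic (M k)) (hMrev : ∀ k, DetailedBalance ν (M k)) (hM0 : ∀ u v, M 0 u v = ν v)
    {c : ℕ} (hc1 : 1 ≤ c) (hunif : ∀ i : Fin K, (univ.filter fun r : Fin m => κ r = i).card = c) (hmc : m = c * K)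
    (u : S) (hu : ν u ≤ 1 / 2) :
    ((K : ℝ) / (t * (1 - t)) - 1) * Real.log (((K : ℝ) + t) / max 260 (8 * Real.sqrt (2 * ((K : ℝ) + 1))))
      ≤ (mixingTime (fun y z : Fin (K + 1) → S => t * ptGraphSwap (fun _ : Fin (K + 1) => ν)
          (fun r : Fin m => (((0 : Fin (K + 1)), (κ r).succ) : Fin (K + 1) × Fin (K + 1))) (fun _ => Equiv.refl S) y z
          + (1 - t) * prodKernel (fun k : Fin (K + 1) => if k = 0 then (1 : ℝ) else 0) M y z) (tensorFun (fun _ : Fin (K + 1) => ν)) (1 / 4) : ℝ) := by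
  classical
  set P := (fun y z : Fin (K + 1) → S => t * ptGraphSwap (fun _ : Fin (K + 1) => ν)
          (fun r : Fin m => (((0 : Fin (K + 1)), (κ r).succ) : Fin (K + 1) × Fin (K + 1))) (fun _ => Equiv.refl S) y z
          + (1 - t) * prodKernel (fun k : Fin (K + 1) => if k = 0 then (1 : ℝ) else 0) M y z) with hP
  set C : ℝ := max 260 (8 * Real.sqrt (2 * ((K : ℝ) + 1))) with hC
  have hKpos : (0 : ℝ) < K := by exact_mod_cast (by omega : 0 < K)
  have hCpos : 0 < C := lt_of_lt_of_le (by norm_num) (le_max_left _ _)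
  have hK2 : (2 : ℝ) ≤ K := by exact_mod_cast hK
  have h1t : 0 < 1 - t := by linarith
  have hθ0 : 0 < t * (1 - t) / K := div_pos (mul_pos ht0 h1t) hKpos
  have hθ1 : t * (1 - t) / K < 1 := by rw [div_lt_one hKpos]; nlinarith
  have hKt : (0 : ℝ) < (K : ℝ) + t := by linarith
  -- structure: row sums, stationarity, convergence (chapter L file 15)
  have hν' : ∀ (k : Fin (K + 1)) (v : S), 0 < (fun _ : Fin (K + 1) => ν) k v := fun _ v => hν v
  have hw0 : ∀ k : Fin (K + 1), 0 ≤ (if k = 0 then (1 : ℝ) else 0) := fun k => by split_ifs <;> norm_num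
  have hw1 : ∑ k : Fin (K + 1), (if k = 0 then (1 : ℝ) else 0) = 1 := by rw [Finset.sum_ite_eq' univ (0 : Fin (K + 1))]; simp
  have h1 := ptGraphSwap_isRowStochastic (e := fun r : Fin m => (((0 : Fin (K + 1)), (κ r).succ) : Fin (K + 1) × Fin (K + 1))) (φ := fun _ => Equiv.refl S) hν'
  have h2 := prodKernel_isRowStochastic (P := M) (w := fun k : Fin (K + 1) => if k = 0 then (1 : ℝ) else 0) hw0 hw1 hM
  have hPrs : IsRowStochastic P := by
    refine ⟨fun y z => add_nonneg (mul_nonneg ht0.le (h1.1 y z)) (mul_nonneg (by linarith) (h2.1 y z)), fun y => ?_⟩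
    rw [hP]; simp only
    rw [sum_add_distrib, ← mul_sum, ← mul_sum, h1.2 y, h2.2 y]; ring
  have hDB : DetailedBalance (tensorFun (fun _ : Fin (K + 1) => ν)) P := by
    have d1 := ptGraphSwap_detailedBalance (e := fun r : Fin m => (((0 : Fin (K + 1)), (κ r).succ) : Fin (K + 1) × Fin (K + 1))) (φ := fun _ => Equiv.refl S) hν'
    have d2 := prodKernel_detailedBalance (π := fun _ : Fin (K + 1) => ν) (P := M) (fun k => hMrev k) (w := fun k : Fin (K + 1) => if k = 0 then (1 : ℝ) else 0)
    intro y z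
    rw [hP]; simp only
    linear_combination t * (d1 y z) + (1 - t) * (d2 y z)
  have hst : IsStationary (tensorFun (fun _ : Fin (K + 1) => ν)) P := hDB.isStationary hPrs.2
  have hc : ∀ p : Fin K, c ≤ (univ.filter (fun r : Fin m => κ r = p)).card := fun p => (hunif p).ge
  have hcm : c ≤ m := by rw [hmc]; exact Nat.le_mul_of_pos_right c (by omega)
  have hmix : ∃ t₀, worstTvDist P (tensorFun (fun _ : Fin (K + 1) => ν)) t₀ ≤ 1 / 4 :=
    ⟨_, idealStar_worstTvDist_le_of_ge_log κ hm ht0 ht1 hν hν1 hM hM0 hc1 hc hcm (by norm_num : (0:ℝ) < 1 / 4) (Nat.le_ceil _)⟩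
  -- the floor: if `n ≤ (K/(t(1−t)) − 1)·log((K+t)/C)` then `(1−λ)ⁿ(K+t) ≥ C`, so `d(n) ≥ 1/2 > 1/4`
  by_contra h
  push Not at h
  set n := mixingTime P (tensorFun (fun _ : Fin (K + 1) => ν)) (1 / 4) with hn
  have hconv : (K : ℝ) / (t * (1 - t)) - 1 = (1 - t * (1 - t) / K) / (t * (1 - t) / K) := by field_simp
  rw [hconv] at h
  have hge : C ≤ (1 - t * (1 - t) / K) ^ n * ((K : ℝ) + t) := by
    have h1θ : 0 < 1 - t * (1 - t) / K := by linarith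
    have hle := mul_le_mul_of_nonneg_left h.le (div_pos hθ0 h1θ).le
    have e0 : t * (1 - t) / K / (1 - t * (1 - t) / K) * ((1 - t * (1 - t) / K) / (t * (1 - t) / K)) = 1 := by
      rw [div_mul_div_comm, mul_comm (t * (1 - t) / K) (1 - t * (1 - t) / K)]; exact div_self (mul_ne_zero h1θ.ne' hθ0.ne')
    have e1 : t * (1 - t) / K / (1 - t * (1 - t) / K) * ((1 - t * (1 - t) / K) / (t * (1 - t) / K) * Real.log (((K : ℝ) + t) / C)) = Real.log (((K : ℝ) + t) / C) := by
      rw [← mul_assoc, e0, one_mul]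
    have e2 : t * (1 - t) / K / (1 - t * (1 - t) / K) * (n : ℝ) = n * (t * (1 - t) / K) / (1 - t * (1 - t) / K) := by ring
    rw [e1, e2] at hle
    calc C = ((K : ℝ) + t) * Real.exp (-Real.log (((K : ℝ) + t) / C)) := by rw [Real.exp_neg, Real.exp_log (div_pos hKt hCpos)]; field_simp
      _ ≤ ((K : ℝ) + t) * Real.exp (-(n * (t * (1 - t) / K) / (1 - t * (1 - t) / K))) := mul_le_mul_of_nonneg_left (Real.exp_le_exp.mpr (neg_le_neg hle)) hKt.le
      _ ≤ ((K : ℝ) + t) * (1 - t * (1 - t) / K) ^ n := mul_le_mul_of_nonneg_left (one_sub_pow_ge_exp hθ1 n) hKt.le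
      _ = (1 - t * (1 - t) / K) ^ n * ((K : ℝ) + t) := mul_comm _ _
  have hs64 : 260 ≤ (1 - t * (1 - t) / K) ^ n * ((K : ℝ) + t) := le_trans (le_max_left _ _) hge
  have hs8 : 8 * Real.sqrt (2 * ((K : ℝ) + 1)) ≤ (1 - t * (1 - t) / K) ^ n * ((K : ℝ) + t) := le_trans (le_max_right _ _) hge
  have hfloor := idealStar_tvDist_ge_lawFree_unit κ hm ht0 ht1 hK hν hν1 hM hM0 hunif hmc u hu n hs64 hs8
  have hd : worstTvDist P (tensorFun (fun _ : Fin (K + 1) => ν)) n ≤ 1 / 4 := by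
    obtain ⟨t₀, ht₀⟩ := hmix
    exact worstTvDist_le_of_mixingTime_le hPrs hst ht₀ le_rfl
  have hw := tvDist_single_le_worstTvDist P (tensorFun (fun _ : Fin (K + 1) => ν)) n (fun _ : Fin (K + 1) => u)
  linarith

/-- **THE TWO-SIDED `K·log K` LAW IN THE UNIT `K/(t(1−t))` FOR EVERY CONTENT LAW:** `|S| ≥ 2`, any positive unit-mass `ν`, uniform listing (`c ≥ 1`, `m = cK`), `K ≥ 2`, `0 < t < 1`,
exact hot sampler, `ν`-reversible cold kernels: for any `u` with `ν(u) ≤ ½`,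
**`(K/(t(1−t)) − 1)·log((K+t)/max{260, 8√(2(K+1))}) ≤ t_mix(1/4) ≤ ⌈(2m/(t(1−t)c))·log((K+1)/(t/4))⌉`**. [ours] -/
theorem idealStar_KlogK_lawFree_unit (hm : 1 ≤ m) (ht0 : 0 < t) (ht1 : t < 1) (hK : 2 ≤ K) (hν : ∀ v, 0 < ν v) (hν1 : ∑ v, ν v = 1)
    (hM : ∀ k, IsRowStochastic (M k)) (hMrev : ∀ k, DetailedBalance ν (M k)) (hM0 : ∀ u v, M 0 u v = ν v)
    {c : ℕ} (hc1 : 1 ≤ c) (hunif : ∀ i : Fin K, (univ.filter fun r : Fin m => κ r = i).card = c) (hmc : m = c * K)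
    (u : S) (hu : ν u ≤ 1 / 2) :
    ((K : ℝ) / (t * (1 - t)) - 1) * Real.log (((K : ℝ) + t) / max 260 (8 * Real.sqrt (2 * ((K : ℝ) + 1))))
        ≤ (mixingTime (fun y z : Fin (K + 1) → S => t * ptGraphSwap (fun _ : Fin (K + 1) => ν)
            (fun r : Fin m => (((0 : Fin (K + 1)), (κ r).succ) : Fin (K + 1) × Fin (K + 1))) (fun _ => Equiv.refl S) y z
            + (1 - t) * prodKernel (fun k : Fin (K + 1) => if k = 0 then (1 : ℝ) else 0) M y z)
          (tensorFun (fun _ : Fin (K + 1) => ν)) (1 / 4) : ℝ) ∧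
      mixingTime (fun y z : Fin (K + 1) → S => t * ptGraphSwap (fun _ : Fin (K + 1) => ν)
            (fun r : Fin m => (((0 : Fin (K + 1)), (κ r).succ) : Fin (K + 1) × Fin (K + 1))) (fun _ => Equiv.refl S) y z
            + (1 - t) * prodKernel (fun k : Fin (K + 1) => if k = 0 then (1 : ℝ) else 0) M y z)
          (tensorFun (fun _ : Fin (K + 1) => ν)) (1 / 4)
        ≤ ⌈2 * (m : ℝ) / (t * (1 - t) * c) * Real.log (((K : ℝ) + 1) / (t * (1 / 4)))⌉₊ := by
  have hc : ∀ p : Fin K, c ≤ (univ.filter (fun r : Fin m => κ r = p)).card := fun p => (hunif p).ge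
  have hcm : c ≤ m := by rw [hmc]; exact Nat.le_mul_of_pos_right c (by omega)
  exact ⟨idealStar_mixingTime_ge_lawFree_unit κ hm ht0 ht1 hK hν hν1 hM hMrev hM0 hc1 hunif hmc u hu,
    idealStar_mixingTime_le κ hm ht0 ht1 hν hν1 hM hM0 hc1 hc hcm (by norm_num)⟩

end LawFreeUnit

end Summit.Ventures.LatticeQCDFlow.Scaling

end
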